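import Literature.MathematicalPhysics.QuantumFieldTheory.Balaban1983to89.B6CubeNormSuppInDecayV1
import Literature.MathematicalPhysics.QuantumFieldTheory.Balaban1983to89.B6Prop25Eq113TwoScaleV1
import Literature.MathematicalPhysics.QuantumFieldTheory.Balaban1983to89.B6HolderPairMemberV1
import Literature.MathematicalPhysics.QuantumFieldTheory.Balaban1983to89.B6BlockDecayHprimeCovV1

/-!
# `Balaban1983to89.B6CubeHolderNormSuppInDecayV1` — T. Bałaban, *Propagators and renormalization transformations for lattice gauge theories. II*,
Comm. Math. Phys. **96** (1984) 223–250 [Balaban1984PropagatorsII], Prop. 2.6 (2.139) p. 247 with (2.133)/(2.141) p. 247 and p. 238 (`T_□`):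
**THE LETTER OF (2.139) PER CUBE — THE PAIR DIFFERENCE `P_{x,x′}·∇_μG_□∇_ν*` OF THE TWO-DIFFERENCE MEMBER ON THE CENSUS HÖLDER CLASS
`‖·‖_{α+ε} + |·|`, TRANSPLANTED THROUGH THE WINDOW** (the member (1.113) of [Balaban1984PropagatorsI] for `G_□` read on the global V1 torus: the
Hölder-output twin of p27's `…B6CubeNormSuppInDecayV1.hDGDla_cube`/`hEGE_cube`, the Hölder-input twin of p22's `…B6CubeHolderInDecayV1.hHEGin_cube`).

HONEST FRAMING (programme rule): statement-level skeleton of published theorems with citation tags; proofs where landed; nothing here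
is a claim about the Yang–Mills mass gap.

PRINT.  [4] = CMP **95** Prop. 1.2 (1.113) p. 36: «‖ζ∇G∇*J‖_α ≤ O(1)e^{−δ₀|y−y′|}(‖ζ‖_α + |ζ|)(‖J‖_{α+ε} + |J|) for 0 ≤ α < 1, ε > 0, α + ε < 1,
ζ ∈ C₀^∞(Δ̃(y)), supp J ⊂ Δ̃(y′)»; CMP **96** (2.133) p. 247: «For G_□ we have the inequalities (1.110)–(1.117) of [4] with δ₂ instead of δ₀»;
(2.139) p. 247: «‖ζ∇G∇*J‖_α ≤ O(1)(L^jη)^{−α}(‖ζ‖^ξ_α + |ζ|)e^{−δ₃d(y,y′)}(‖J‖^{ξ′}_{α+ε} + |J|)»; p. 238: «We take the cube □̃³ and identify it with a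
torus, denoted by T_□».

## WHAT THIS FILE CERTIFIES (kernel-checked, sorry-free, standard axioms; THEOREMS ONLY)

* §1 **`ineq113_pair_hasMajorantA`** — THE MEMBER (1.113) AS A PAIR MAJORANT ON THE MEMBER GEOMETRY: for `0 ≤ α`, `0 < ε`, `α + ε < 1` and every radius
  `r ≥ 1` there is ONE `(δ, C)` such that for every member `i` of the genuine two-scale family, directions `μ, λ` and same-direction fine bonds `b₁, b₂`
  with `|b₁₋ − b₂₋|_∞ ≤ Lʲ`: `HasMajorantA (tsGeo i R M) (y(·₋)) (NormSupp radius-r (‖·‖_{α+ε} + |·|)) (P_{b₁,b₂}·∇_μG_□∇_λ*)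
  (C·e^{(1+2δ)(r+4)}·t^α·e^{−δ|y − y′|_T})`, `t = |b₁₋ − b₂₋|_∞/Lʲ` — p38/r03's `…B6Prop25Eq113TwoScaleV1.prop25_ineq113_rateFree` with the cut-off
  `ζ := 1_{balls of radius r about y(b₁₋)}` (`‖ζ‖_α`-part `0`, `|ζ| ≤ 1`; the block of `b₂` is adjacent: `BIJ85Ineq722Torus.supDist_blk_le_one`);
* §2 `pairOp_translate_mul_EC_Gl_EC_eq` — `P_{c₁+v,c₂+v}·(E_(μ,+)G_□E_(ν,−)) = τ_{−v}·(s(□)⁻¹•ε(P_{ec₁,ec₂}·∇_μG_t∇_ν*)ρ)·τ_v` for window bonds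
  (p27's `EC_Gl_EC_eq` + p22's `TB_neg_mul_pairOp_mul_TB`/`transplant_pairOp_mul`);
* §3 **`hHEGE_cube`** — ON THE GLOBAL V1 TORUS (`L ≥ 5`, `M_h = Lᵃ ≥ 2`, `R ≥ 2L²`, cube placed): for window bonds `c₁, c₂` of the same direction
  with charted initial points at sup-distance `≤ L^{j_t}`,
  `HasMajorantA (geomT D) (blkV1 hN D) (y′ ∈ Q^T_□ ∧ NormSupp {y′} (‖·‖_{α+ε} + |·|)) (P_{c₁+v,c₂+v}·(E_(μ,+)·G_□·E_(ν,−))) (s(□)⁻¹·C·t_m^α·e^{−ρ d_T})`,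
  `t_m` the member quotient — p27's Hölder-class window bridge `normSuppDecay_cube` fired on the member pair letter of §1 (radius `L − 1`).

## HONEST SCOPE

(1) The close pairs of ONE cube in the chart frame only; the passage to admissible global pairs (far pairs by two single-point letters, the
activity/level/placement geometry of p22's `…B6HolderPairGeometryV1`) and the assembly of the n = 0 legs of (2.139) are NOT here.  (2) Thresholds as
in p27/p22 (`L ≥ 5`, `M_h = Lᵃ ≥ 2`, `R ≥ 2L²`, placed cube); constants ours on `d, L, a₀, a₁, α, ε`; one rate on `d, L, a₀, a₁`.  (3) Census sub-case
`supp J ⊂ Δ(y′)` (GAPS G-B6-2138-SUPP).  NOT summit progress.  Unit `pub-ymgap-dag-n02-b` (Track-A seat, D-0062; slot c4 of node N03), 2026-08-25.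
-/

noncomputable section

open scoped BigOperators
open Finset

namespace Literature.MathematicalPhysics.QuantumFieldTheory.Balaban1983to89.B6CubeHolderNormSuppInDecayV1

open LatticeFieldCalculus
open B4TorusKernel.MultiPeriod (torusSupNorm torusSupNorm_nonneg)
open B5Eq118OneStroke (iterBlockOf)
open B6MultiLevelBoxOperator (N0)
open B6MultiLevelTorusOperator (TDomains)
open B6Eq238MultiLevelTorus (svec)
open B6Cover236MultiLevelBlocks (cubes)
open B6Geom246MultiLevelBox (bset)
open B6Geom246MultiLevelTorus (geomT)
open B6LowerBound2153Torus (rep)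
open B6GlobalChartV1 (PV toBox blkV1 domT)
open B6AgreeLapV1Chart (cB eB mem_cB_W)
open B6TranslateTorusV1 (vch TB)
open B6Prop25TwoScaleCensus (TSIdx)
open B6Prop25Eq113TwoScaleV1 (prop25_ineq113_rateFree)
open B6Ineq2133TwoScaleV1 (tsGeo onFun onFun_apply tsGeo_dist_self)
open B6Prop26ReachTransplant (transplant)
open B6Prop26KLevelSkeletonV1 (ST)
open B6Partition118KLevelTorusCentral (one_le_of_four_le)
open B6SectAOperatorsV1 (BondIdx)
open B6RandomWalkInputNorm (HasMajorantA NormSupp hasMajorantA_smul hasMajorantA_mono)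
open B6HolderNormV1 (supNormV1 holderV1)
open B6Ineq112NormSuppTS (abs_sub_le_hqB)
open B6Eq292MemberTorusV1 (EC)
open B6CubeWindowV1 (x0 j0 tC sc hx0 hfit Placed wC Gl)
open B6CubeInDecayV1 (conj_mul sc_nonneg)
open B6CubeNormSuppInDecayV1 (normSuppDecay_cube EC_Gl_EC_eq)
open B6HolderPairMemberV1 (pairOp pairOp_mul_apply transplant_pairOp_mul TB_neg_mul_pairOp_mul_TB)
open B6BlockDecayHprimeCovV1 (supDist_cast_eq_torusSupNorm)
open BalabanImbrieJaffe1984to88.BIJ85AxialPropagator411 (BondSpace)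
open BalabanImbrieJaffe1984to88.BIJ85Ineq722Torus (supDist_blk_le_one)

/-! ## §1  The member (1.113) as a pair majorant on the member geometry, Hölder input class of radius `r` -/

section Member

variable {d L : ℕ} {hd : 1 ≤ d + 1} {hL : Odd L ∧ 1 < L} {a₀ a₁ : ℝ}

open Classical in
/-- **[4] (1.113) FOR THE GENUINE TWO-SCALE `G_□`, AS AN ADMISSIBLE-INPUT PAIR MAJORANT ON `T_□`** (Prop. 2.5: *"(1.113) with δ₂ instead of δ₀"*): ONE rate
`δ > 0` (on `d, L, a₀, a₁`) and, for `0 ≤ α`, `0 < ε`, `α + ε < 1`, ONE `C ≥ 0` such that for every radius `r ≥ 1`, member `i`, directions `μ, λ`, and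
same-direction fine bonds `b₁, b₂` with `|b₁₋ − b₂₋|_∞ ≤ Lʲ`:
`|(∇_μG_□∇_λ*J)(b₁) − (∇_μG_□∇_λ*J)(b₂)| ≤ C·e^{(1+2δ)(r+4)}·t^α·e^{−δ|y(b₁₋) − y′|_T}·(‖J‖_{α+ε} + |J|)`, `t = |b₁₋ − b₂₋|_∞/Lʲ`, for every `J` supported over
the blocks within `|·|_T`-distance `r` of `y′` — as `HasMajorantA (P_{b₁,b₂}·onFun(∇_μ∘G_□∘∇_λ*))` on `tsGeo i R M`.
[cite: Balaban1984PropagatorsII, Prop. 2.5 p.246, (2.133) p.247, (2.139) p.247; Balaban1984PropagatorsI, Prop. 1.2 (1.113) p.36, (1.109) p.35] -/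
theorem ineq113_pair_hasMajorantA (d L : ℕ) (hd : 1 ≤ d + 1) (hL : Odd L ∧ 1 < L) {a₀ a₁ : ℝ} (ha₀ : 0 < a₀) (ha₁ : a₀ ≤ a₁) :
    ∃ δ : ℝ, 0 < δ ∧ ∀ α ε : ℝ, 0 ≤ α → 0 < ε → α + ε < 1 → ∃ C : ℝ, 0 ≤ C ∧ ∀ (r : ℝ), 1 ≤ r →
      ∀ (i : TSIdx d L hd hL a₀ a₁) (R M : ℝ) (mu lam : Fin i.P.d) (b₁ b₂ : PBond i.P 0), b₁.dir = b₂.dir → supDist b₁.src b₂.src ≤ L ^ i.j →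
      HasMajorantA (g := tsGeo i R M) (fun b : PBond i.P 0 => iterBlockOf i.j b.src)
        (NormSupp (g := tsGeo i R M) (fun b : PBond i.P 0 => iterBlockOf i.j b.src) (fun y' => {y'' | i.tdist y'' y' ≤ r})
          (fun _ μ => i.hqB (α + ε) (WithLp.toLp 2 μ) + i.supNormTS (.vec (WithLp.toLp 2 μ))))
        (pairOp b₁ b₂ * onFun (i.Dl mu ∘ₗ i.D.G ∘ₗ i.Dla lam))
        (fun y y' => C * Real.exp ((1 + 2 * δ) * (r + 4)) * (((supDist b₁.src b₂.src : ℕ) : ℝ) / (L : ℝ) ^ i.j) ^ α *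
          Real.exp (-(δ * i.tdist y y'))) := by
  obtain ⟨δ, hδ, HE⟩ := prop25_ineq113_rateFree d L hd hL ha₀ ha₁
  refine ⟨δ, hδ, fun α ε hα0 hε0 hαε => ?_⟩
  obtain ⟨CE, hCE, hE⟩ := HE α ε hα0 hε0 hαε
  refine ⟨CE, hCE, ?_⟩
  intro r hr i R M mu lam b₁ b₂ hdir hle y' μ B hμ z
  set J : BondSpace i.P := WithLp.toLp 2 μ with hJdef
  have ht0 : 0 ≤ (((supDist b₁.src b₂.src : ℕ) : ℝ) / (L : ℝ) ^ i.j) ^ α := Real.rpow_nonneg (by positivity) _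
  have hK0 : 0 ≤ CE * Real.exp ((1 + 2 * δ) * (r + 4)) * (((supDist b₁.src b₂.src : ℕ) : ℝ) / (L : ℝ) ^ i.j) ^ α *
      Real.exp (-(δ * i.tdist (iterBlockOf i.j z.src) y')) := by positivity
  rw [pairOp_mul_apply]
  by_cases hz : z = b₁
  swap
  · rw [if_neg hz, abs_zero]; exact mul_nonneg hK0 hμ.nonneg
  rw [if_pos hz]
  subst hz
  -- the data of the member theorem
  have hX0 : 0 ≤ i.supNormTS (.vec J) := i.supNormTS_nonneg _
  have hXε0 : 0 ≤ i.hqB (α + ε) J := i.hqB_nonneg (α + ε) J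
  have hr0 : 0 ≤ r := zero_le_one.trans hr
  have hsupp : ∀ b : PBond i.P 0, J b ≠ 0 → i.tdist (iterBlockOf i.j b.src) y' ≤ r := by
    intro b hb
    by_contra hnot
    exact hb (hμ.off b hnot)
  have hJb : ∀ b : PBond i.P 0, |J b| ≤ i.supNormTS (.vec J) := fun b => i.abs_le_supNormTS_vec J b
  have hH : ∀ b b' : PBond i.P 0, b.dir = b'.dir → supDist b.src b'.src ≤ L ^ i.j →
      |J b - J b'| ≤ i.hqB (α + ε) J * (((supDist b.src b'.src : ℕ) : ℝ) / (L : ℝ) ^ i.j) ^ (α + ε) := by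
    intro b b' hdir' _
    rw [← i.fdist_eq b.src b'.src]
    exact abs_sub_le_hqB i (by linarith) J b b' hdir'
  -- the cut-off: the indicator of the blocks within `r` of `y(b₁₋)`; both ends of the pair carry the value `1`
  set y₀ : Site i.P i.j := iterBlockOf i.j z.src with hy₀
  set ζ : Site i.P 0 → ℝ := fun x => if i.tdist (iterBlockOf i.j x) y₀ ≤ r then 1 else 0 with hζ
  have hζs : ∀ x : Site i.P 0, ζ x ≠ 0 → i.tdist (iterBlockOf i.j x) y₀ ≤ r := by
    intro x hx
    by_contra hnot
    exact hx (by simp only [hζ]; rw [if_neg hnot])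
  have hζ0 : ∀ x : Site i.P 0, |ζ x| ≤ 1 := fun x => by
    simp only [hζ]; split_ifs <;> simp
  have hζz : ζ z.src = 1 := by
    simp only [hζ]; rw [if_pos]; rw [hy₀, show i.tdist (iterBlockOf i.j z.src) (iterBlockOf i.j z.src) = 0 from tsGeo_dist_self i R M _]; exact hr0
  have hζb₂ : ζ b₂.src = 1 := by
    simp only [hζ]; rw [if_pos]
    have hblk : i.tdist (iterBlockOf i.j b₂.src) y₀ ≤ 1 := by
      rw [hy₀]
      unfold TSIdx.tdist
      rw [← supDist_cast_eq_torusSupNorm]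
      have h1 := supDist_blk_le_one (P := i.P) (Nat.le_of_succ_le i.hj) b₂.src z.src (by rwa [B3TorusRadialSums.supDist_comm])
      exact_mod_cast h1
    exact hblk.trans hr
  have hζh : |ζ z.src - ζ b₂.src| ≤ 0 * (((supDist z.src b₂.src : ℕ) : ℝ) / (L : ℝ) ^ i.j) ^ α := by
    rw [hζz, hζb₂, sub_self, abs_zero, zero_mul]
  have key := hE i.m i.K i.j i.hc i.hj i.Λ' i.w i.hw0 i.hw1 lam mu r hr0 J (i.supNormTS (.vec J)) (i.hqB (α + ε) J)
    hX0 hXε0 y₀ y' hsupp hJb hH ζ 0 1 le_rfl zero_le_one hζs hζ0 z b₂ hdir hle hζh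
  rw [hζz, hζb₂, one_mul, one_mul, zero_add, mul_one] at key
  have hB : i.hqB (α + ε) J + i.supNormTS (.vec J) ≤ B := hμ.bound
  calc |onFun (i.Dl mu ∘ₗ i.D.G ∘ₗ i.Dla lam) μ z - onFun (i.Dl mu ∘ₗ i.D.G ∘ₗ i.Dla lam) μ b₂|
      = |i.Dl mu (i.D.G (i.Dla lam J)) z - i.Dl mu (i.D.G (i.Dla lam J)) b₂| := by rfl
    _ ≤ CE * Real.exp ((1 + 2 * δ) * (r + 4)) * Real.exp (-(δ * i.tdist y₀ y')) * (i.hqB (α + ε) J + i.supNormTS (.vec J)) *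
          (((supDist z.src b₂.src : ℕ) : ℝ) / (L : ℝ) ^ i.j) ^ α := key
    _ ≤ CE * Real.exp ((1 + 2 * δ) * (r + 4)) * Real.exp (-(δ * i.tdist y₀ y')) * B *
          (((supDist z.src b₂.src : ℕ) : ℝ) / (L : ℝ) ^ i.j) ^ α :=
        mul_le_mul_of_nonneg_right (mul_le_mul_of_nonneg_left hB (by positivity)) ht0
    _ = CE * Real.exp ((1 + 2 * δ) * (r + 4)) * (((supDist z.src b₂.src : ℕ) : ℝ) / (L : ℝ) ^ i.j) ^ α *
          Real.exp (-(δ * i.tdist y₀ y')) * B := by ring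

end Member

/-! ## §2  The operator identity for the pair difference of `E_(μ,+)·G_□·E_(ν,−)` -/

section Identity

variable {d ℓ : ℕ} {hd : 1 ≤ d + 1} {hL : Odd (ℓ + 1) ∧ 1 < ℓ + 1} {a₀ a₁ : ℝ} {m K : ℕ} {Mh k R : ℕ} {P' : Fin (d + 1) → ℕ}
variable (hN : ∀ μ, N0 ℓ Mh k P' μ = (PV d ℓ m K hd hL).sitesPerDir 0) {D : TDomains d ℓ Mh k P' R} (hk : k ≤ m + K)
  (hMh1 : 1 ≤ Mh) (hP4 : ∀ μ, 4 ≤ P' μ) {a : ℕ} (hMha : Mh = (ℓ + 1) ^ a) (c : ↥(cubes D.toDomains)) (ha : a₀ ≤ a₁)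

/-- **`P_{c₁+v,c₂+v}·(E_(μ,+)·G_□·E_(ν,−)) = τ_{−v}·(s(□)⁻¹•ε(P_{ec₁,ec₂}·∇_μG_t∇_ν*)ρ)·τ_v`** for window bonds `c₁, c₂` of the chart frame: p27's
`EC_Gl_EC_eq`, the translation of the pair operator and its passage through the (injective) window transplant.
[cite: Balaban1984PropagatorsII, (2.133) p.247, (2.92)/(2.94) p.239, p.238 (T_□ = □̃³); dictionary (charts), derivation ours] -/
theorem pairOp_translate_mul_EC_Gl_EC_eq (hpl : Placed ℓ k P' c.1) (w : BondIdx (domT hN D hk) → ℝ) (cf : ℝ) (μ ν : Fin (d + 1))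
    {c₁ c₂ : PBond (PV d ℓ m K hd hL) 0}
    (hc₁ : c₁ ∈ (cB (tC hN hk hMh1 hP4 c ha a (wC hN hk c w) cf) (x0 ℓ Mh k c.1) (hx0 hpl) (hfit hN hMh1 hP4 hMha c ha hpl)).W)
    (hc₂ : c₂ ∈ (cB (tC hN hk hMh1 hP4 c ha a (wC hN hk c w) cf) (x0 ℓ Mh k c.1) (hx0 hpl) (hfit hN hMh1 hP4 hMha c ha hpl)).W) :
    pairOp (c₁.translate (vch Mh k (svec ℓ k c.1.1 c.1.2))) (c₂.translate (vch Mh k (svec ℓ k c.1.1 c.1.2))) *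
        (EC hN hk hMh1 hP4 hMha c ha hpl w cf (μ, true) * Gl hN hk hMh1 hP4 hMha c ha hpl w cf * EC hN hk hMh1 hP4 hMha c ha hpl w cf (ν, false)) =
      TB (-vch Mh k (svec ℓ k c.1.1 c.1.2)) *
        ((sc hMh1 hP4 c cf)⁻¹ • transplant (cB (tC hN hk hMh1 hP4 c ha a (wC hN hk c w) cf) (x0 ℓ Mh k c.1) (hx0 hpl) (hfit hN hMh1 hP4 hMha c ha hpl)).W
          (eB (tC hN hk hMh1 hP4 c ha a (wC hN hk c w) cf) (x0 ℓ Mh k c.1))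
          (pairOp (eB (tC hN hk hMh1 hP4 c ha a (wC hN hk c w) cf) (x0 ℓ Mh k c.1) c₁) (eB (tC hN hk hMh1 hP4 c ha a (wC hN hk c w) cf) (x0 ℓ Mh k c.1) c₂) *
            onFun ((tC hN hk hMh1 hP4 c ha a (wC hN hk c w) cf).Dl μ ∘ₗ (tC hN hk hMh1 hP4 c ha a (wC hN hk c w) cf).D.G ∘ₗ
              (tC hN hk hMh1 hP4 c ha a (wC hN hk c w) cf).Dla ν))) *
        TB (vch Mh k (svec ℓ k c.1.1 c.1.2)) := by
  rw [EC_Gl_EC_eq, ← TB_neg_mul_pairOp_mul_TB (vch Mh k (svec ℓ k c.1.1 c.1.2)) c₁ c₂, conj_mul, mul_smul_comm,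
    transplant_pairOp_mul (W := (cB (tC hN hk hMh1 hP4 c ha a (wC hN hk c w) cf) (x0 ℓ Mh k c.1) (hx0 hpl) (hfit hN hMh1 hP4 hMha c ha hpl)).W)
      (e := eB (tC hN hk hMh1 hP4 c ha a (wC hN hk c w) cf) (x0 ℓ Mh k c.1))
      (cB (tC hN hk hMh1 hP4 c ha a (wC hN hk c w) cf) (x0 ℓ Mh k c.1) (hx0 hpl) (hfit hN hMh1 hP4 hMha c ha hpl)).inj _ hc₁ hc₂]

end Identity

/-! ## §3  The letter of (2.139) per cube: the pair difference of `E_(μ,+)·G_□·E_(ν,−)` on the census Hölder class -/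

section Letter

variable {d ℓ : ℕ} {hd : 1 ≤ d + 1} {hL : Odd (ℓ + 1) ∧ 1 < ℓ + 1}

/-- **THE LETTER `P_{x,x′}·E_(μ,+)·G_□·E_(ν,−)` OF (2.139) ON THE CENSUS HÖLDER CLASS, PER CUBE, CLOSE PAIRS IN THE CHART FRAME** (`L ≥ 5`): there is
`ρ > 0` (on `d, L, a₀, a₁`) and, for `0 ≤ α`, `0 < ε`, `α + ε < 1`, a constant `C ≥ 0` such that on every V1 global torus (`M_h = Lᵃ ≥ 2`, `R ≥ 2L²`), for
every placed cube `□`, weights, fine factor, directions `μ, ν` and window bonds `c₁, c₂` of the same direction with charted initial points at sup-distance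
`≤ L^{j_t}`:  `HasMajorantA (geomT D) (blkV1 hN D) (y′ ∈ Q^T_□ ∧ NormSupp {y′} (‖·‖_{α+ε} + |·|)) (P_{c₁+v,c₂+v}·(E_(μ,+)G_□E_(ν,−)))
(s(□)⁻¹·C·t_m^α·e^{−ρ d_T})`, `t_m = |ec₁ − ec₂|_∞/L^{j_t}` — print's `O(1)e^{−δ₃d}(‖J‖_{α+ε} + |J|)·|x − x′|^α` for the two-difference member, the
unit `s(□)⁻¹` cancelled downstream by the two `(c′/L^{j₀})` of the sandwich.
[cite: Balaban1984PropagatorsII, Prop. 2.6 (2.139) p.247, (2.133) p.247, (2.92)–(2.94) p.239, p.238; Balaban1984PropagatorsI, Prop. 1.2 (1.113) p.36] -/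
theorem hHEGE_cube (d ℓ : ℕ) (hd : 1 ≤ d + 1) (hL : Odd (ℓ + 1) ∧ 1 < ℓ + 1) {a₀ a₁ : ℝ} (ha₀ : 0 < a₀) (ha₁ : a₀ ≤ a₁) :
    ∃ ρ : ℝ, 0 < ρ ∧ ∀ α ε : ℝ, 0 ≤ α → 0 < ε → α + ε < 1 → ∃ C : ℝ, 0 ≤ C ∧ ∀ (m K : ℕ) {Mh k R : ℕ} {P' : Fin (d + 1) → ℕ}
      (hN : ∀ μ, N0 ℓ Mh k P' μ = (PV d ℓ m K hd hL).sitesPerDir 0) (D : TDomains d ℓ Mh k P' R) (hk : k ≤ m + K)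
      (hMh1 : 1 ≤ Mh) (hP4 : ∀ μ, 4 ≤ P' μ) {a : ℕ} (hMha : Mh = (ℓ + 1) ^ a) (_ : 2 ≤ Mh) (_ : 2 * (ℓ + 1) ^ 2 ≤ R) (_ : 4 ≤ ℓ)
      (c : ↥(cubes D.toDomains)) (hpl : Placed ℓ k P' c.1) (w : BondIdx (domT hN D hk) → ℝ) (cf : ℝ) (μ ν : Fin (d + 1))
      (c₁ c₂ : PBond (PV d ℓ m K hd hL) 0)
      (_ : c₁ ∈ (cB (tC hN hk hMh1 hP4 c ha₁ a (wC hN hk c w) cf) (x0 ℓ Mh k c.1) (hx0 hpl) (hfit hN hMh1 hP4 hMha c ha₁ hpl)).W)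
      (_ : c₂ ∈ (cB (tC hN hk hMh1 hP4 c ha₁ a (wC hN hk c w) cf) (x0 ℓ Mh k c.1) (hx0 hpl) (hfit hN hMh1 hP4 hMha c ha₁ hpl)).W)
      (_ : c₁.dir = c₂.dir)
      (_ : supDist (eB (tC hN hk hMh1 hP4 c ha₁ a (wC hN hk c w) cf) (x0 ℓ Mh k c.1) c₁).src
        (eB (tC hN hk hMh1 hP4 c ha₁ a (wC hN hk c w) cf) (x0 ℓ Mh k c.1) c₂).src ≤ (ℓ + 1) ^ (tC hN hk hMh1 hP4 c ha₁ a (wC hN hk c w) cf).j),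
      HasMajorantA (g := geomT D) (blkV1 hN D)
        (fun J y' B => y' ∈ ST D hMh1 hP4 c ∧ NormSupp (g := geomT D) (blkV1 hN D) (fun y' => ({y'} : Set (geomT D).Site))
          (fun _ J => holderV1 hN D (α + ε) J + supNormV1 J) J y' B)
        (pairOp (c₁.translate (vch Mh k (svec ℓ k c.1.1 c.1.2))) (c₂.translate (vch Mh k (svec ℓ k c.1.1 c.1.2))) *
          (EC hN hk hMh1 hP4 hMha c ha₁ hpl w cf (μ, true) * Gl hN hk hMh1 hP4 hMha c ha₁ hpl w cf * EC hN hk hMh1 hP4 hMha c ha₁ hpl w cf (ν, false)))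
        (fun y y' => (sc hMh1 hP4 c cf)⁻¹ * (C * (((supDist (eB (tC hN hk hMh1 hP4 c ha₁ a (wC hN hk c w) cf) (x0 ℓ Mh k c.1) c₁).src
            (eB (tC hN hk hMh1 hP4 c ha₁ a (wC hN hk c w) cf) (x0 ℓ Mh k c.1) c₂).src : ℕ) : ℝ) /
            (((ℓ + 1 : ℕ) : ℝ)) ^ (tC hN hk hMh1 hP4 c ha₁ a (wC hN hk c w) cf).j) ^ α * Real.exp (-(ρ * (geomT D).dist y y')))) := by
  obtain ⟨δ, hδ, HE⟩ := ineq113_pair_hasMajorantA d (ℓ + 1) hd hL ha₀ ha₁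
  refine ⟨δ / (((d : ℝ) + 1) * ((9 : ℕ) : ℝ)), by positivity, fun α ε hα0 hε0 hαε => ?_⟩
  obtain ⟨CE, hCE, hE⟩ := HE α ε hα0 hε0 hαε
  refine ⟨3 * (CE * Real.exp ((1 + 2 * δ) * ((ℓ : ℝ) + 4)) * Real.exp (δ * (((d : ℝ) + 1) + ((d : ℝ) + 1)) / (((d : ℝ) + 1) * ((9 : ℕ) : ℝ)))),
    by positivity, ?_⟩
  intro m K Mh k R P' hN D hk hMh1 hP4 a hMha hMh hR2 hℓ c hpl w cf μ ν c₁ c₂ hc₁ hc₂ hdir hle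
  have hℓ1 : (1 : ℝ) ≤ (ℓ : ℝ) := by exact_mod_cast le_trans (by norm_num) hℓ
  -- the relative distance factor of the pair on `T_□` (a constant for the transport)
  set τ : ℝ := (((supDist (eB (tC hN hk hMh1 hP4 c ha₁ a (wC hN hk c w) cf) (x0 ℓ Mh k c.1) c₁).src
    (eB (tC hN hk hMh1 hP4 c ha₁ a (wC hN hk c w) cf) (x0 ℓ Mh k c.1) c₂).src : ℕ) : ℝ) /
    (((ℓ + 1 : ℕ) : ℝ)) ^ (tC hN hk hMh1 hP4 c ha₁ a (wC hN hk c w) cf).j) ^ α with hτ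
  have hτ0 : 0 ≤ τ := Real.rpow_nonneg (by positivity) _
  -- the member's pair majorant on the Hölder class of radius `L − 1`
  have hmem := hE (ℓ : ℝ) hℓ1 (tC hN hk hMh1 hP4 c ha₁ a (wC hN hk c w) cf) 0 0 μ ν
    (eB (tC hN hk hMh1 hP4 c ha₁ a (wC hN hk c w) cf) (x0 ℓ Mh k c.1) c₁) (eB (tC hN hk hMh1 hP4 c ha₁ a (wC hN hk c w) cf) (x0 ℓ Mh k c.1) c₂) hdir hle
  have hmem' : HasMajorantA (g := tsGeo (tC hN hk hMh1 hP4 c ha₁ a (wC hN hk c w) cf) 0 0)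
      (fun β : PBond (tC hN hk hMh1 hP4 c ha₁ a (wC hN hk c w) cf).P 0 => iterBlockOf (tC hN hk hMh1 hP4 c ha₁ a (wC hN hk c w) cf).j β.src)
      (NormSupp (g := tsGeo (tC hN hk hMh1 hP4 c ha₁ a (wC hN hk c w) cf) 0 0)
        (fun β : PBond (tC hN hk hMh1 hP4 c ha₁ a (wC hN hk c w) cf).P 0 => iterBlockOf (tC hN hk hMh1 hP4 c ha₁ a (wC hN hk c w) cf).j β.src)
        (fun y' => {y'' | (tC hN hk hMh1 hP4 c ha₁ a (wC hN hk c w) cf).tdist y'' y' ≤ (ℓ : ℝ)})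
        (fun _ f => (tC hN hk hMh1 hP4 c ha₁ a (wC hN hk c w) cf).hqB (α + ε) (WithLp.toLp 2 f) +
          (tC hN hk hMh1 hP4 c ha₁ a (wC hN hk c w) cf).supNormTS (.vec (WithLp.toLp 2 f))))
      (pairOp (eB (tC hN hk hMh1 hP4 c ha₁ a (wC hN hk c w) cf) (x0 ℓ Mh k c.1) c₁) (eB (tC hN hk hMh1 hP4 c ha₁ a (wC hN hk c w) cf) (x0 ℓ Mh k c.1) c₂) *
        onFun ((tC hN hk hMh1 hP4 c ha₁ a (wC hN hk c w) cf).Dl μ ∘ₗ (tC hN hk hMh1 hP4 c ha₁ a (wC hN hk c w) cf).D.G ∘ₗ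
          (tC hN hk hMh1 hP4 c ha₁ a (wC hN hk c w) cf).Dla ν))
      (fun y y' => (CE * Real.exp ((1 + 2 * δ) * ((ℓ : ℝ) + 4)) * τ) * Real.exp (-(δ * (tC hN hk hMh1 hP4 c ha₁ a (wC hN hk c w) cf).tdist y y'))) := by
    refine hasMajorantA_mono _ hmem (fun _ _ _ hμ => hμ.nonneg) fun y y' => le_of_eq ?_
    rw [hτ]
  -- through the window to the global torus (p27's Hölder-class bridge, any member operator)
  have h1 := normSuppDecay_cube hN hk hMh1 hP4 hMha c ha₁ hℓ hMh hR2 hpl w cf (by linarith : 0 ≤ α + ε) (by positivity) hδ.le hmem'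
  -- the unit `s(□)⁻¹` and the operator identity
  have h2 := hasMajorantA_smul (g := geomT D) (blkV1 hN D) h1 (sc hMh1 hP4 c cf)⁻¹
  rw [pairOp_translate_mul_EC_Gl_EC_eq hN hk hMh1 hP4 hMha c ha₁ hpl w cf μ ν hc₁ hc₂, mul_smul_comm, smul_mul_assoc]
  refine hasMajorantA_mono (g := geomT D) (blkV1 hN D) h2 (fun _ _ _ hμ => hμ.2.nonneg) fun y y' => le_of_eq ?_
  rw [abs_of_nonneg (inv_nonneg.2 (sc_nonneg hMh1 hP4 c cf)), hτ]
  ring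

end Letter

end Literature.MathematicalPhysics.QuantumFieldTheory.Balaban1983to89.B6CubeHolderNormSuppInDecayV1

end
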